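import Summits.Ventures.HodgeRepro2.T5SU11KernelCompositionSymmetric
import Summits.Ventures.HodgeRepro2.T5SU11ResolventIterateSymmetric

/-!
# The powers of the resolvent are the integral operators of the composed kernels

The composed kernel `K_λ^{∘(n+1)}(t, s) = (G^I_λ)ⁿ K_λ(·, s)(t)` is the kernel of the power `(G^I_λ)^{n+1}` on the
class of continuous sources bounded near `0` and decaying at a rate `> 1` — without Fubini: the outer resolvent is
the pairing with the kernel source `K_λ(t, ·)` (row 524), the powers are symmetric on the class (row 583), and the
composed kernels are symmetric (row 582):

* `iterate_succ_eq_integral` — **`(G^I_λ)^{n+1} g(t) = ∫ K_λ^{∘(n+1)}(t, r) g(r) sinh 2r dr`**;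
* `kernel_comp_add` — **Chapman–Kolmogorov: `K_λ^{∘(m+n+2)}(t, s) = ∫ K_λ^{∘(m+1)}(t, r) K_λ^{∘(n+1)}(r, s) sinh 2r dr`**
  (the case `g = K_λ^{∘(n+1)}(·, s)`, a class source at every rate `< λ`, row 503).

Nothing is claimed about (N).

Blind lane: Mathlib + the HodgeRepro2 prefix only; no sorry; axioms ⊆ {propext, Classical.choice,
Quot.sound}.
-/

namespace Summit.Ventures.HodgeRepro2.T5SU11ResolventIterateKernel

open Filter Topology MeasureTheory
open Set (Ioi Ioc)
open T5SU11Cartan T5SU11SphericalFunction T5SU11SphericalDecay T5SU11RadialGreenKernel T5SU11RadialGreenImproper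
  T5SU11RadialGreenImproperDecaySource T5SU11ResolventKernelComposition T5SU11KernelDifferenceRegularity
  T5SU11ResolventNeumann T5SU11KernelCompositionSymmetric T5SU11ResolventIterateSymmetric

section measure

variable [MeasurableSpace Circle] [BorelSpace Circle]

variable {lam : ℝ} (hlam : 1 < lam)
  {g : ℝ → ℝ} (hg : ContinuousOn g (Ioi 0))
  {M : ℝ} (hM : ∀ r ∈ Ioc (0 : ℝ) 1, |g r| ≤ M) (hM0 : 0 ≤ M)
  {ε C s₀ : ℝ} (hε : 2 - lam < ε) (hε1 : 1 < ε) (hC : ∀ r, s₀ ≤ r → |g r| ≤ C * Real.exp (-ε * r))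

include hlam hg hM hM0 hε hε1 hC in
/-- **The powers of the resolvent are the integral operators of the composed kernels**: for a class source `g` of a
rate `ε > 1`, `(G^I_λ)^{n+1} g(t) = ∫ (G^I_λ)ⁿ K_λ(·, r)(t) · g(r) sinh 2r dr` for every `t > 0`. -/
theorem iterate_succ_eq_integral (n : ℕ) {t : ℝ} (ht : 0 < t) :
    ((greenSolI (fun t => sph lam (hyp t)) (sphDecay lam))^[n + 1] g) t
      = ∫ r in Ioi 0, ((greenSolI (fun t => sph lam (hyp t)) (sphDecay lam))^[n] (fun u => sphGreenKernel lam u r)) t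
          * g r * Real.sinh (2 * r) := by
  -- the class data of `(G^I_λ)ⁿ g` at the rate `(1 + min(ε, λ))/2 ∈ (1, min(ε, λ))` (row 503)
  have hmin : 1 < min ε lam := lt_min hε1 hlam
  obtain ⟨hcn, ⟨Mn, hMn0, hMn⟩, hdn⟩ := iterate_class (lam₂ := lam) hlam hg hM hM0 hε hC n
  obtain ⟨Kn, Tn, _, _, hKn⟩ := hdn ((1 + min ε lam) / 2) (by linarith)
  have hεn : 2 - lam < (1 + min ε lam) / 2 := by linarith [min_le_right ε lam]
  -- the kernel representation of the outer resolvent: `(G^I_λ)^{n+1} g(t) = ⟨K_λ(t, ·), (G^I_λ)ⁿ g⟩`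
  have hB := integrableOn_sph_mul_mul_sinh_Ioc hcn hMn hMn0 lam
  have hA := integrableOn_sphDecay_mul_mul_sinh hlam hcn hMn hMn0 hεn hKn
  rw [Function.iterate_succ_apply', greenSolI_eq_integral_kernel hB hA ht]
  -- the class data of the kernel source `k_t = K_λ(·, t)` (rate `λ > 1`)
  obtain ⟨Mt, hMt0, hMt⟩ := kernel_source_bounded hlam ht
  obtain ⟨Ct, s₀t, hCt⟩ := kernel_source_decay hlam ht
  have hkt := kernel_source_continuousOn hlam ht
  have hεt : 2 - lam < lam := by linarith
  -- `⟨k_t, (G^I_λ)ⁿ g⟩ = ⟨(G^I_λ)ⁿ k_t, g⟩` (row 583), then the symmetry of the composed kernels (row 582)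
  have hsym := inner_iterate_symm hlam hg hM hM0 hε hε1 hC n (fun u => sphGreenKernel lam u t) Mt lam Ct s₀t hkt hMt
    hMt0 hεt hlam hCt
  have e1 : ∫ r in Ioi 0, greenKernel (fun t => sph lam (hyp t)) (sphDecay lam) t r
        * ((greenSolI (fun t => sph lam (hyp t)) (sphDecay lam))^[n] g) r * Real.sinh (2 * r)
      = ∫ r in Ioi 0, (fun u => sphGreenKernel lam u t) r
        * ((greenSolI (fun t => sph lam (hyp t)) (sphDecay lam))^[n] g) r * Real.sinh (2 * r) := by
    apply setIntegral_congr_fun measurableSet_Ioi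
    intro r _
    simp only [sphGreenKernel]
    rw [greenKernel_symm (fun t => sph lam (hyp t)) (sphDecay lam) t r]
  rw [e1, hsym]
  apply setIntegral_congr_fun measurableSet_Ioi
  intro r hr
  beta_reduce
  rw [kernel_comp_symm hlam n hr ht]

omit hg hM hM0 hε hε1 hC in
include hlam in
/-- **Chapman–Kolmogorov for the composed kernels**:
`K_λ^{∘(m+n+2)}(t, s) = ∫ K_λ^{∘(m+1)}(t, r) K_λ^{∘(n+1)}(r, s) sinh 2r dr`, i.e.
`(G^I_λ)^{m+n+1} K_λ(·, s)(t) = ∫ (G^I_λ)ᵐ K_λ(·, r)(t) · (G^I_λ)ⁿ K_λ(·, s)(r) sinh 2r dr` for `t, s > 0`. -/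
theorem kernel_comp_add (m n : ℕ) {t s : ℝ} (ht : 0 < t) (hs : 0 < s) :
    ((greenSolI (fun t => sph lam (hyp t)) (sphDecay lam))^[m + n + 1] (fun r => sphGreenKernel lam r s)) t
      = ∫ r in Ioi 0, ((greenSolI (fun t => sph lam (hyp t)) (sphDecay lam))^[m] (fun u => sphGreenKernel lam u r)) t
          * ((greenSolI (fun t => sph lam (hyp t)) (sphDecay lam))^[n] (fun r => sphGreenKernel lam r s)) r
          * Real.sinh (2 * r) := by
  -- the class data of `(G^I_λ)ⁿ k_s` at the rate `(1 + λ)/2 ∈ (1, λ)` (row 503)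
  obtain ⟨Ms, hMs0, hMs⟩ := kernel_source_bounded hlam hs
  obtain ⟨Cs, s₀s, hCs⟩ := kernel_source_decay hlam hs
  have hks := kernel_source_continuousOn hlam hs
  have hεs : 2 - lam < lam := by linarith
  obtain ⟨hcs, ⟨Ms', hMs'0, hMs'⟩, hds⟩ := iterate_class (lam₂ := lam) hlam hks hMs hMs0 hεs hCs n
  obtain ⟨Ks, Ts, _, _, hKs⟩ := hds ((1 + lam) / 2) (by rw [min_self]; linarith)
  have hεh : 2 - lam < (1 + lam) / 2 := by linarith
  have hεh1 : 1 < (1 + lam) / 2 := by linarith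
  -- `(G^I_λ)^{m+n+1} k_s = (G^I_λ)^{m+1} ((G^I_λ)ⁿ k_s)`, then the integral representation of the power `m + 1`
  rw [show m + n + 1 = (m + 1) + n by ring, Function.iterate_add_apply]
  exact iterate_succ_eq_integral hlam hcs hMs' hMs'0 hεh hεh1 hKs m ht

end measure

end Summit.Ventures.HodgeRepro2.T5SU11ResolventIterateKernel
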